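import Summits.QuantumFields.YangMills.Theorems.LangevinControlUVOSLegsFromFemtoAndGapStubHypercubicSignedPerm
import Summits.QuantumFields.YangMills.Theorems.LangevinControlUVOSLegsAtWeakCouplingCDefs
import Summits.QuantumFields.YangMills.Theorems.BalabanLadderInfVolRPSeries
import Summits.QuantumFields.GaugeBoot.ClassBLimitSymmetry
import Literature.MathematicalPhysics.QuantumFieldTheory.WilsonAxisSymmetry
import HarnessLib

/-!
# Support `IVEuclideanInvariance` (stmt-QuantumFields-19933), stub W1 `stub_ivSigned`: hyperoctahedral
# (signed-permutation) invariance of the infinite-volume-first continuum data — EXACT on the lattice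

Route `InfiniteVolumeContinuum` (R136 (i), planner `ym-novel-YangMills-infvol`), registered skeleton v1 of the lead
`ym-infvol-p1` (`IVEuclideanInvariance_proof`, sha16 79f0b03fba6b37ab); stub W1
`Summit.QuantumFields.YangMills.Theorems.InfiniteVolume.E1.stub_ivSigned` with the REGISTERED signature, proved by seat
`ym-infvol-p3`.  HONEST FRAMING: pure soft analysis (exact lattice symmetries + uniqueness of limits); the route is
conditional on Track A's UV Prop `BalabanLadder.UV`; existence half only (OS0–OS3); nothing here is a mass gap or Clay.

MECHANISM.  DATA pins, for `n ≥ 2`, `S₁ n = Σ_{q valid} T n q`, `T n q F = lim_k Σ'ₓ W_{μ_k}(q,x)·F(centres)`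
(`W = stateMomentStr`, plaquette-CENTRE smearing, `μ_k ∈ oddTorusLimitPoints r (β k)`).  Odd-torus limit states are
torus limit points, hence invariant under the coordinate permutations `configPermZd π` and the site mirror
`configSiteReflect 0` (GaugeBoot).  Plane fields AND plaquette centres transform covariantly under both:
`plane q x (P_π U) = plane (permPlane π⁻¹ q) (sitePermZd π⁻¹ x) U` (`plane_configPermZd`; re-sorting is free since
`Re tr ρ(g⁻¹) = Re tr ρ(g)`) with `coordPerm_symm_centrePoint`, and `plane q x (Θ U) = plane q (reflSite q x) U`
(toolkit `InfVolRP.plane_cfgReflect`) with `timeReflection_centrePoint` — with CENTRE smearing the time reflection is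
EXACT at every spacing (no `O(a)` shift defect, unlike the base-point convention of the spine's toolkit XXIV-a).  So
the lattice functionals agree at `P_π F` and `F` (re-index `x`, relabel the valid strings by `permPlane`) and at `Θ F`
and `F` (re-index `x` by the involution `reflSite`) for EVERY `k`; the limits agree (§5); arities `0, 1` are the
conventions `S₁ 0 = ev`, `S₁ 1 = 0`; signed permutations are generated by the two (spine toolkit XXIV-b
`invariant_linActMulti_of_signedPerm`).

References: K. Osterwalder, R. Schrader, CMP 31 (1973) §2 (E1); E. Seiler, LNP 159 (1982) Ch. 2 (hypercubic symmetry
of Wilson's action and its Gibbs states); H.-O. Georgii, Gibbs Measures (2011) §5.1.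
-/
set_option autoImplicit false

noncomputable section

open scoped SchwartzMap BigOperators
open MeasureTheory Filter Topology
open Literature.MathematicalPhysics.QuantumFieldTheory hiding ZdEdge
open Literature.MathematicalPhysics.QuantumLattice
open Literature.MathematicalPhysics.AQFT
open Literature.Probability.LatticeModels (Site)
open Summit.QuantumFields.YangMills.Cruxes.OSLegsFromFemtoAndGap.DlrCollarTransfer (plane)
open Summit.QuantumFields.YangMills.Theorems.OSLegsFromFemtoAndGap
  (permPlane permPlane_valid sum_planeStrings_permPlane coordPerm coordPerm_apply coordPerm_single
    mem_planeStrings_iff invariant_linActMulti_of_signedPerm)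
open Summit.QuantumFields.YangMills.Theorems.InfVolRP (reflSite reflSite_reflSite reflSite_apply_zero
  reflSite_apply_of_ne plane_cfgReflect configSiteReflect_zero_eq_cfgReflect
  mem_infiniteVolumeLimitPoints_of_mem_oddTorusLimitPoints)
open Summit.QuantumFields.GaugeBoot (configSiteReflect configSiteReflect_configSiteReflect
  measurable_configSiteReflect map_configPermZd_eq_of_mem_infiniteVolumeLimitPoints
  map_configSiteReflect_zero_eq_of_mem_infiniteVolumeLimitPoints)

namespace Summit.QuantumFields.YangMills.Theorems.InfiniteVolume

variable {G : Type} [Group G] [TopologicalSpace G] [IsTopologicalGroup G] [CompactSpace G]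
  [MeasurableSpace G] [BorelSpace G]

/-! ## §1 Covariance of the plane fields under the coordinate permutations of `ℤ⁴` -/

omit [MeasurableSpace G] [BorelSpace G] in
/-- The plaquette observable of a re-sorted plane is that of the unsorted one (`Re tr ρ(g⁻¹) = Re tr ρ(g)`). [folklore] -/
theorem plaquetteObs_permPlane (r : LatticeRep G) (σ : Equiv.Perm (Fin 4)) (p : Fin 4 × Fin 4) (V : LGConfig 4 G) :
    plaquetteObs r.ρ 0 (permPlane σ p).1 (permPlane σ p).2 V = plaquetteObs r.ρ 0 (σ p.1) (σ p.2) V := by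
  unfold permPlane
  split_ifs
  · rfl
  · exact plaquetteObs_swap r.ρ r.continuous 0 _ _ V

omit [BorelSpace G] in
/-- **Covariance of the single-plane fields under the coordinate permutations of `ℤ⁴`**:
`plane q x (P_π U) = plane (permPlane π⁻¹ q) (sitePermZd π⁻¹ x) U`. [folklore] -/
theorem plane_configPermZd (r : LatticeRep G) (π : Equiv.Perm (Fin 4)) (q : Fin 4 × Fin 4) (x : Site 4)
    (U : LGConfig 4 G) :
    plane G r q x (configPermZd π U) = plane G r (permPlane π.symm q) (sitePermZd π.symm x) U := by
  unfold plane
  have hshift : configShift (-x) (configPermZd π U) = configPermZd π (configShift (-sitePermZd π.symm x) U) := by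
    rw [configPermZd_configShift, sitePermZd_neg, sitePermZd_apply_symm_apply]
  rw [hshift, plaquetteObs_configPermZd, sitePermZd_zero, plaquetteObs_permPlane]

/-! ## §2 Symmetric states: covariant strings have equal centred moments -/

omit [Group G] [TopologicalSpace G] [IsTopologicalGroup G] [CompactSpace G] [BorelSpace G] in
/-- Change of variables under a symmetry of the state (`μ ∘ Φ⁻¹ = μ`). [folklore] -/
theorem integral_comp_eq_of_map_eq {μ : Measure (LGConfig 4 G)} (Φ : LGConfig 4 G ≃ᵐ LGConfig 4 G)
    (hΦ : μ.map Φ = μ) (f : LGConfig 4 G → ℝ) : ∫ U, f (Φ U) ∂μ = ∫ U, f U ∂μ := by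
  rw [← integral_map_equiv Φ f, hΦ]

omit [IsTopologicalGroup G] [CompactSpace G] [BorelSpace G] in
/-- **Covariant plane strings have the same centred moment in a symmetric state**: if `μ ∘ Φ⁻¹ = μ` and
`plane (q i) (x i) ∘ Φ = plane (q' i) (x' i)` for every `i`, then `W_μ(q, x) = W_μ(q', x')`. [folklore] -/
theorem stateMomentStr_eq_of_covariant (r : LatticeRep G) {μ : Measure (LGConfig 4 G)}
    (Φ : LGConfig 4 G ≃ᵐ LGConfig 4 G) (hΦ : μ.map Φ = μ) {n : ℕ} {q q' : Fin n → Fin 4 × Fin 4}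
    {x x' : Fin n → Site 4} (hcov : ∀ i U, plane G r (q i) (x i) (Φ U) = plane G r (q' i) (x' i) U) :
    stateMomentStr G r μ n q x = stateMomentStr G r μ n q' x' := by
  unfold stateMomentStr
  have hc : ∀ i, ∫ V, plane G r (q i) (x i) V ∂μ = ∫ V, plane G r (q' i) (x' i) V ∂μ := fun i =>
    calc ∫ V, plane G r (q i) (x i) V ∂μ = ∫ V, plane G r (q i) (x i) (Φ V) ∂μ :=
          (integral_comp_eq_of_map_eq Φ hΦ (fun V => plane G r (q i) (x i) V)).symm
      _ = ∫ V, plane G r (q' i) (x' i) V ∂μ := by simp_rw [hcov i]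
  calc ∫ U, ∏ i, (plane G r (q i) (x i) U - ∫ V, plane G r (q i) (x i) V ∂μ) ∂μ
      = ∫ U, ∏ i, (plane G r (q i) (x i) (Φ U) - ∫ V, plane G r (q i) (x i) V ∂μ) ∂μ :=
        (integral_comp_eq_of_map_eq Φ hΦ
          (fun U => ∏ i, (plane G r (q i) (x i) U - ∫ V, plane G r (q i) (x i) V ∂μ))).symm
    _ = ∫ U, ∏ i, (plane G r (q' i) (x' i) U - ∫ V, plane G r (q' i) (x' i) V ∂μ) ∂μ := by
        simp_rw [hcov, hc]

omit [BorelSpace G] in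
/-- **String weights of a `P_π`-symmetric state**: `W_μ(q, x) = W_μ(permPlane π⁻¹ ∘ q, sitePermZd π⁻¹ ∘ x)`. [folklore] -/
theorem stateMomentStr_configPermZd (r : LatticeRep G) {μ : Measure (LGConfig 4 G)} (π : Equiv.Perm (Fin 4))
    (hμ : μ.map (configPermZd π) = μ) {n : ℕ} (q : Fin n → Fin 4 × Fin 4) (x : Fin n → Site 4) :
    stateMomentStr G r μ n q x =
      stateMomentStr G r μ n (fun i => permPlane π.symm (q i)) (fun i => sitePermZd π.symm (x i)) :=
  stateMomentStr_eq_of_covariant r (configPermZd π) hμ fun i U => plane_configPermZd r π (q i) (x i) U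

/-- **String weights of a `Θ`-symmetric state** (site mirror `x₀ ↦ −x₀`): for a valid string,
`W_μ(q, x) = W_μ(q, reflSite ∘ (q, x))`. [folklore] -/
theorem stateMomentStr_reflSite [SecondCountableTopology G] (r : LatticeRep G) {μ : Measure (LGConfig 4 G)}
    (hμ : μ.map (configSiteReflect 0) = μ) {n : ℕ} {q : Fin n → Fin 4 × Fin 4} (hq : ∀ i, (q i).1 < (q i).2)
    (x : Fin n → Site 4) :
    stateMomentStr G r μ n q x = stateMomentStr G r μ n q (fun i => reflSite (q i) (x i)) := by
  let Θ : LGConfig 4 G ≃ᵐ LGConfig 4 G :=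
    { toFun := configSiteReflect 0
      invFun := configSiteReflect 0
      left_inv := configSiteReflect_configSiteReflect 0
      right_inv := configSiteReflect_configSiteReflect 0
      measurable_toFun := measurable_configSiteReflect 0
      measurable_invFun := measurable_configSiteReflect 0 }
  have hΘ : μ.map Θ = μ := hμ
  exact stateMomentStr_eq_of_covariant r Θ hΘ fun i U => by
    show plane G r (q i) (x i) (configSiteReflect 0 U) = _
    rw [configSiteReflect_zero_eq_cfgReflect, plane_cfgReflect r (hq i)]

/-! ## §3 The plaquette centres under `P_π⁻¹` and under the time reflection -/

/-- `P_π⁻¹ = P_{π⁻¹}`. [folklore] -/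
theorem coordPerm_symm (π : Equiv.Perm (Fin 4)) : (coordPerm π).symm = coordPerm π.symm := by
  unfold coordPerm
  exact LinearIsometryEquiv.piLpCongrLeft_symm π

/-- The sum of the two unit vectors of a plane does not see the sorting. [folklore] -/
theorem single_add_single_permPlane (σ : Equiv.Perm (Fin 4)) (q : Fin 4 × Fin 4) :
    EuclideanSpace.single (permPlane σ q).1 (1 : ℝ) + EuclideanSpace.single (permPlane σ q).2 (1 : ℝ) =
      EuclideanSpace.single (σ q.1) (1 : ℝ) + EuclideanSpace.single (σ q.2) (1 : ℝ) := by
  unfold permPlane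
  split_ifs
  · rfl
  · exact add_comm _ _

/-- **`P_π⁻¹` maps the centre of the plaquette `(q, y)` to the centre of the plaquette
`(permPlane π⁻¹ q, sitePermZd π⁻¹ y)`** (in units `a`). [folklore] -/
theorem coordPerm_symm_centrePoint (π : Equiv.Perm (Fin 4)) (a : ℝ) (q : Fin 4 × Fin 4) (y : Site 4) :
    (coordPerm π).symm (a • siteToE y +
        (a / 2) • (EuclideanSpace.single q.1 (1 : ℝ) + EuclideanSpace.single q.2 (1 : ℝ))) =
      a • siteToE (sitePermZd π.symm y) +
        (a / 2) • (EuclideanSpace.single (permPlane π.symm q).1 (1 : ℝ) +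
          EuclideanSpace.single (permPlane π.symm q).2 (1 : ℝ)) := by
  have hsite : (coordPerm π).symm (siteToE y) = siteToE (sitePermZd π.symm y) := by
    ext k
    rw [coordPerm_symm, coordPerm_apply, siteToE_apply, siteToE_apply, sitePermZd_apply, Equiv.symm_symm]
  rw [map_add, map_smul, map_smul, map_add, hsite, single_add_single_permPlane, coordPerm_symm, coordPerm_single,
    coordPerm_single]

/-- **The time reflection maps the centre of the plaquette `(q, y)` to the centre of the reflected plaquette
`(q, reflSite q y)`** (valid `q`; in units `a`): with centre smearing the site mirror acts on the evaluation points
EXACTLY as `timeReflection 4`. [folklore] -/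
theorem timeReflection_centrePoint (a : ℝ) {q : Fin 4 × Fin 4} (hq : q.1 < q.2) (y : Site 4) :
    timeReflection 4 (a • siteToE y +
        (a / 2) • (EuclideanSpace.single q.1 (1 : ℝ) + EuclideanSpace.single q.2 (1 : ℝ))) =
      a • siteToE (reflSite q y) +
        (a / 2) • (EuclideanSpace.single q.1 (1 : ℝ) + EuclideanSpace.single q.2 (1 : ℝ)) := by
  have hj : (0 : Fin 4) ≠ q.2 := fun h => by rw [← h] at hq; exact (Fin.not_lt_zero _) hq
  ext k
  by_cases hk : k = 0
  · subst hk
    simp only [timeReflection_apply, if_true, PiLp.add_apply, PiLp.smul_apply, smul_eq_mul, siteToE_apply,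
      reflSite_apply_zero, PiLp.single_apply, hj, if_false, add_zero]
    by_cases h1 : q.1 = 0
    · rw [if_pos h1.symm, if_pos h1]
      push_cast
      ring
    · rw [if_neg (Ne.symm h1), if_neg h1]
      push_cast
      ring
  · simp only [timeReflection_apply, hk, if_false, PiLp.add_apply, PiLp.smul_apply, smul_eq_mul, siteToE_apply,
      reflSite_apply_of_ne q y hk]

/-! ## §4 The centre-smeared string functionals are exactly invariant on the lattice -/

omit [BorelSpace G] in
/-- **One string under a coordinate permutation**: for a `P_π`-symmetric state,
`Σ'ₓ W_μ(q,x)·(P_π F)(centres of (q,x)) = Σ'ₓ W_μ(permPlane π⁻¹ ∘ q, x)·F(centres of (permPlane π⁻¹ ∘ q, x))`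
(re-indexing `x ↦ sitePermZd π⁻¹ ∘ x`). [folklore] -/
theorem tsum_stateMomentStr_mul_linActMulti_coordPerm (r : LatticeRep G) {μ : Measure (LGConfig 4 G)}
    (π : Equiv.Perm (Fin 4)) (hμ : μ.map (configPermZd π) = μ) (a : ℝ) {n : ℕ} (q : Fin n → Fin 4 × Fin 4)
    (F : 𝓢((Fin n → EuclideanSpace ℝ (Fin 4)), ℂ)) :
    ∑' x : Fin n → (Fin 4 → ℤ), ((stateMomentStr G r μ n q x : ℝ) : ℂ) *
        linActMulti (coordPerm π) F (fun l => a • siteToE (x l) +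
          (a / 2) • (EuclideanSpace.single (q l).1 (1 : ℝ) + EuclideanSpace.single (q l).2 (1 : ℝ))) =
      ∑' x : Fin n → (Fin 4 → ℤ), ((stateMomentStr G r μ n (fun l => permPlane π.symm (q l)) x : ℝ) : ℂ) *
        F (fun l => a • siteToE (x l) +
          (a / 2) • (EuclideanSpace.single (permPlane π.symm (q l)).1 (1 : ℝ) +
            EuclideanSpace.single (permPlane π.symm (q l)).2 (1 : ℝ))) := by
  let e : (Fin n → (Fin 4 → ℤ)) ≃ (Fin n → (Fin 4 → ℤ)) := Equiv.piCongrRight fun _ => sitePermZd π.symm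
  have hre : ∀ x : Fin n → (Fin 4 → ℤ),
      ((stateMomentStr G r μ n q x : ℝ) : ℂ) *
          linActMulti (coordPerm π) F (fun l => a • siteToE (x l) +
            (a / 2) • (EuclideanSpace.single (q l).1 (1 : ℝ) + EuclideanSpace.single (q l).2 (1 : ℝ))) =
        ((stateMomentStr G r μ n (fun l => permPlane π.symm (q l)) (fun l => sitePermZd π.symm (x l)) : ℝ) : ℂ) *
          F (fun l => a • siteToE (sitePermZd π.symm (x l)) +
            (a / 2) • (EuclideanSpace.single (permPlane π.symm (q l)).1 (1 : ℝ) +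
              EuclideanSpace.single (permPlane π.symm (q l)).2 (1 : ℝ))) := fun x => by
    rw [linActMulti_apply, stateMomentStr_configPermZd r π hμ q x]
    simp_rw [coordPerm_symm_centrePoint]
  simp_rw [hre]
  exact e.tsum_eq (fun y : Fin n → (Fin 4 → ℤ) =>
    ((stateMomentStr G r μ n (fun l => permPlane π.symm (q l)) y : ℝ) : ℂ) *
      F (fun l => a • siteToE (y l) +
        (a / 2) • (EuclideanSpace.single (permPlane π.symm (q l)).1 (1 : ℝ) +
          EuclideanSpace.single (permPlane π.symm (q l)).2 (1 : ℝ))))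

omit [BorelSpace G] in
/-- **THE STRING-SUM FUNCTIONAL IS EXACTLY INVARIANT UNDER COORDINATE PERMUTATIONS** (plaquette-centre smearing,
`P_π`-symmetric state): relabel the valid strings by `permPlane π⁻¹`. [folklore] -/
theorem sum_tsum_stateMomentStr_mul_linActMulti_coordPerm (r : LatticeRep G) {μ : Measure (LGConfig 4 G)}
    (π : Equiv.Perm (Fin 4)) (hμ : μ.map (configPermZd π) = μ) (a : ℝ) {n : ℕ}
    (F : 𝓢((Fin n → EuclideanSpace ℝ (Fin 4)), ℂ)) :
    ∑ q ∈ Fintype.piFinset (fun _ : Fin n => Finset.univ.filter fun p : Fin 4 × Fin 4 => p.1 < p.2),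
        ∑' x : Fin n → (Fin 4 → ℤ), ((stateMomentStr G r μ n q x : ℝ) : ℂ) *
          linActMulti (coordPerm π) F (fun l => a • siteToE (x l) +
            (a / 2) • (EuclideanSpace.single (q l).1 (1 : ℝ) + EuclideanSpace.single (q l).2 (1 : ℝ))) =
      ∑ q ∈ Fintype.piFinset (fun _ : Fin n => Finset.univ.filter fun p : Fin 4 × Fin 4 => p.1 < p.2),
        ∑' x : Fin n → (Fin 4 → ℤ), ((stateMomentStr G r μ n q x : ℝ) : ℂ) *
          F (fun l => a • siteToE (x l) +
            (a / 2) • (EuclideanSpace.single (q l).1 (1 : ℝ) + EuclideanSpace.single (q l).2 (1 : ℝ))) := by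
  simp_rw [tsum_stateMomentStr_mul_linActMulti_coordPerm r π hμ a]
  exact sum_planeStrings_permPlane π.symm (fun q => ∑' x : Fin n → (Fin 4 → ℤ),
    ((stateMomentStr G r μ n q x : ℝ) : ℂ) * F (fun l => a • siteToE (x l) +
      (a / 2) • (EuclideanSpace.single (q l).1 (1 : ℝ) + EuclideanSpace.single (q l).2 (1 : ℝ))))

/-- **EACH STRING FUNCTIONAL IS EXACTLY INVARIANT UNDER THE TIME REFLECTION** (plaquette-centre smearing, valid
string, `Θ`-symmetric state): re-index by the involution `x ↦ reflSite ∘ (q, x)`. [folklore] -/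
theorem tsum_stateMomentStr_mul_thetaMulti [SecondCountableTopology G] (r : LatticeRep G)
    {μ : Measure (LGConfig 4 G)} (hμ : μ.map (configSiteReflect 0) = μ) (a : ℝ) {n : ℕ}
    {q : Fin n → Fin 4 × Fin 4} (hq : ∀ i, (q i).1 < (q i).2) (F : 𝓢((Fin n → EuclideanSpace ℝ (Fin 4)), ℂ)) :
    ∑' x : Fin n → (Fin 4 → ℤ), ((stateMomentStr G r μ n q x : ℝ) : ℂ) *
        thetaMulti 4 F (fun l => a • siteToE (x l) +
          (a / 2) • (EuclideanSpace.single (q l).1 (1 : ℝ) + EuclideanSpace.single (q l).2 (1 : ℝ))) =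
      ∑' x : Fin n → (Fin 4 → ℤ), ((stateMomentStr G r μ n q x : ℝ) : ℂ) *
        F (fun l => a • siteToE (x l) +
          (a / 2) • (EuclideanSpace.single (q l).1 (1 : ℝ) + EuclideanSpace.single (q l).2 (1 : ℝ))) := by
  let e : (Fin n → (Fin 4 → ℤ)) ≃ (Fin n → (Fin 4 → ℤ)) :=
    Equiv.piCongrRight fun l => Function.Involutive.toPerm (reflSite (q l)) (reflSite_reflSite (q l))
  have hθpt : ∀ (l : Fin n) (y : Fin 4 → ℤ),
      timeReflection 4 (a • siteToE y +
          (a / 2) • (EuclideanSpace.single (q l).1 (1 : ℝ) + EuclideanSpace.single (q l).2 (1 : ℝ))) =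
        a • siteToE (reflSite (q l) y) +
          (a / 2) • (EuclideanSpace.single (q l).1 (1 : ℝ) + EuclideanSpace.single (q l).2 (1 : ℝ)) :=
    fun l y => timeReflection_centrePoint a (hq l) y
  have hre : ∀ x : Fin n → (Fin 4 → ℤ),
      ((stateMomentStr G r μ n q x : ℝ) : ℂ) *
          thetaMulti 4 F (fun l => a • siteToE (x l) +
            (a / 2) • (EuclideanSpace.single (q l).1 (1 : ℝ) + EuclideanSpace.single (q l).2 (1 : ℝ))) =
        ((stateMomentStr G r μ n q (fun l => reflSite (q l) (x l)) : ℝ) : ℂ) *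
          F (fun l => a • siteToE (reflSite (q l) (x l)) +
            (a / 2) • (EuclideanSpace.single (q l).1 (1 : ℝ) + EuclideanSpace.single (q l).2 (1 : ℝ))) := fun x => by
    rw [thetaMulti_apply, stateMomentStr_reflSite r hμ hq x]
    simp_rw [hθpt]
  simp_rw [hre]
  exact e.tsum_eq (fun y : Fin n → (Fin 4 → ℤ) => ((stateMomentStr G r μ n q y : ℝ) : ℂ) *
    F (fun l => a • siteToE (y l) +
      (a / 2) • (EuclideanSpace.single (q l).1 (1 : ℝ) + EuclideanSpace.single (q l).2 (1 : ℝ))))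

/-! ## §5 Inheritance by the limits -/

omit [BorelSpace G] in
/-- **The limit string-sum is invariant under coordinate permutations.**  `P_π`-symmetric states `μ_k`, scales
`a_k`, and limits `T q` with `Σ'ₓ W_{μ_k}(q,x)·F(centres) → T q F` for every valid `q` and `F ∈ ⁰𝒮ₙ`: then
`Σ_{q valid} T q (P_π F) = Σ_{q valid} T q F` on `⁰𝒮ₙ`. [folklore] -/
theorem sum_limit_linActMulti_coordPerm_eq (r : LatticeRep G) (μ : ℕ → Measure (LGConfig 4 G)) (a : ℕ → ℝ)
    (hμ : ∀ (k : ℕ) (π : Equiv.Perm (Fin 4)), (μ k).map (configPermZd π) = μ k) {n : ℕ}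
    (T : (Fin n → Fin 4 × Fin 4) → 𝓢((Fin n → EuclideanSpace ℝ (Fin 4)), ℂ) → ℂ)
    (hconv : ∀ q : Fin n → Fin 4 × Fin 4, (∀ i, (q i).1 < (q i).2) →
      ∀ F : 𝓢((Fin n → EuclideanSpace ℝ (Fin 4)), ℂ), IsOffDiagonal F →
        Tendsto (fun k => ∑' x : Fin n → (Fin 4 → ℤ), ((stateMomentStr G r (μ k) n q x : ℝ) : ℂ) *
          F (fun l => a k • siteToE (x l) +
            (a k / 2) • (EuclideanSpace.single (q l).1 (1 : ℝ) + EuclideanSpace.single (q l).2 (1 : ℝ))))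
          atTop (𝓝 (T q F)))
    (π : Equiv.Perm (Fin 4)) (F : 𝓢((Fin n → EuclideanSpace ℝ (Fin 4)), ℂ)) (hF : IsOffDiagonal F) :
    ∑ q ∈ Fintype.piFinset (fun _ : Fin n => Finset.univ.filter fun p : Fin 4 × Fin 4 => p.1 < p.2),
        T q (linActMulti (coordPerm π) F) =
      ∑ q ∈ Fintype.piFinset (fun _ : Fin n => Finset.univ.filter fun p : Fin 4 × Fin 4 => p.1 < p.2), T q F := by
  classical
  set P := Fintype.piFinset (fun _ : Fin n => Finset.univ.filter fun p : Fin 4 × Fin 4 => p.1 < p.2) with hP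
  have hmemP : ∀ q, q ∈ P → ∀ i, (q i).1 < (q i).2 := fun q hq => (mem_planeStrings_iff q).1 (hP ▸ hq)
  have h1 : Tendsto (fun k => ∑ q ∈ P, ∑' x : Fin n → (Fin 4 → ℤ), ((stateMomentStr G r (μ k) n q x : ℝ) : ℂ) *
      linActMulti (coordPerm π) F (fun l => a k • siteToE (x l) +
        (a k / 2) • (EuclideanSpace.single (q l).1 (1 : ℝ) + EuclideanSpace.single (q l).2 (1 : ℝ))))
      atTop (𝓝 (∑ q ∈ P, T q (linActMulti (coordPerm π) F))) :=
    tendsto_finsetSum _ fun q hq => hconv q (hmemP q hq) _ (hF.linActMulti (coordPerm π))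
  have h2 : Tendsto (fun k => ∑ q ∈ P, ∑' x : Fin n → (Fin 4 → ℤ), ((stateMomentStr G r (μ k) n q x : ℝ) : ℂ) *
      F (fun l => a k • siteToE (x l) +
        (a k / 2) • (EuclideanSpace.single (q l).1 (1 : ℝ) + EuclideanSpace.single (q l).2 (1 : ℝ))))
      atTop (𝓝 (∑ q ∈ P, T q F)) :=
    tendsto_finsetSum _ fun q hq => hconv q (hmemP q hq) F hF
  exact tendsto_nhds_unique
    (h1.congr fun k => sum_tsum_stateMomentStr_mul_linActMulti_coordPerm r π (hμ k π) (a k) F) h2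

/-- **Each limit string functional is invariant under the time reflection.**  `Θ`-symmetric states `μ_k`, scales
`a_k`, a valid string `q` and the limit `T q` of `Σ'ₓ W_{μ_k}(q,x)·F(centres)` on `⁰𝒮ₙ`: then `T q (Θ F) = T q F`.
[folklore] -/
theorem limit_thetaMulti_eq [SecondCountableTopology G] (r : LatticeRep G) (μ : ℕ → Measure (LGConfig 4 G))
    (a : ℕ → ℝ) (hμ : ∀ k : ℕ, (μ k).map (configSiteReflect 0) = μ k) {n : ℕ}
    (T : (Fin n → Fin 4 × Fin 4) → 𝓢((Fin n → EuclideanSpace ℝ (Fin 4)), ℂ) → ℂ)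
    (hconv : ∀ q : Fin n → Fin 4 × Fin 4, (∀ i, (q i).1 < (q i).2) →
      ∀ F : 𝓢((Fin n → EuclideanSpace ℝ (Fin 4)), ℂ), IsOffDiagonal F →
        Tendsto (fun k => ∑' x : Fin n → (Fin 4 → ℤ), ((stateMomentStr G r (μ k) n q x : ℝ) : ℂ) *
          F (fun l => a k • siteToE (x l) +
            (a k / 2) • (EuclideanSpace.single (q l).1 (1 : ℝ) + EuclideanSpace.single (q l).2 (1 : ℝ))))
          atTop (𝓝 (T q F)))
    {q : Fin n → Fin 4 × Fin 4} (hq : ∀ i, (q i).1 < (q i).2) (F : 𝓢((Fin n → EuclideanSpace ℝ (Fin 4)), ℂ))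
    (hF : IsOffDiagonal F) : T q (thetaMulti 4 F) = T q F := by
  exact tendsto_nhds_unique ((hconv q hq (thetaMulti 4 F) (hF.linActMulti (timeReflection 4))).congr fun k =>
    tsum_stateMomentStr_mul_thetaMulti r (hμ k) (a k) hq F) (hconv q hq F hF)

end Summit.QuantumFields.YangMills.Theorems.InfiniteVolume

/-! ## §6 The registered stub W1 `stub_ivSigned`, BY NAME and with the registered signature -/

namespace Summit.QuantumFields.YangMills.Theorems.InfiniteVolume.E1

open Summit.QuantumFields.YangMills.Cruxes.OSLegsAtWeakCouplingC.Sketch (Invariant IsSignedPerm)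

variable {G : Type} [Group G] [TopologicalSpace G] [IsTopologicalGroup G] [CompactSpace G]
  [MeasurableSpace G] [BorelSpace G]

/-- **W1 `stub_ivSigned` — signed-permutation (hyperoctahedral) invariance of `S₁` on `⁰𝒮` from the DATA clause**
(registered stub of the skeleton `IVEuclideanInvariance_proof` of stmt-QuantumFields-19933, lead `ym-infvol-p1`; proved by
seat `ym-infvol-p3`): the odd-torus limit states are invariant under the coordinate permutations and the site mirror of
`ℤ⁴` (GaugeBoot); with plaquette-CENTRE smearing both act on the centre-smeared plane-string series EXACTLY as
`linActMulti (coordPerm π)` ∕ `thetaMulti 4` act on the test function; the limits inherit both; arities `0, 1` are the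
conventions; signed permutations are generated by the two (`invariant_linActMulti_of_signedPerm`).  `hapos` is idle. -/
theorem stub_ivSigned (r : LatticeRep G) (a : ℝ → ℝ) (β : ℕ → ℝ) (μ : ℕ → Measure (LGConfig 4 G))
    (S₁ : SchwingerFamily (EuclideanSpace ℝ (Fin 4)))
    (T : (n : ℕ) → (Fin n → Fin 4 × Fin 4) → (𝓢((Fin n → EuclideanSpace ℝ (Fin 4)), ℂ) →L[ℂ] ℂ))
    (_hapos : ∀ b, 0 < a b) (hμ : ∀ k, μ k ∈ oddTorusLimitPoints r (β k))
    (h0 : ∀ F : 𝓢((Fin 0 → EuclideanSpace ℝ (Fin 4)), ℂ), S₁ 0 F = F default)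
    (h1 : ∀ F : 𝓢((Fin 1 → EuclideanSpace ℝ (Fin 4)), ℂ), S₁ 1 F = 0)
    (hS : ∀ n : ℕ, 2 ≤ n → ∀ F : 𝓢((Fin n → EuclideanSpace ℝ (Fin 4)), ℂ), S₁ n F =
      ∑ q ∈ Fintype.piFinset (fun _ : Fin n => Finset.univ.filter fun p : Fin 4 × Fin 4 => p.1 < p.2), T n q F)
    (hT : ∀ n : ℕ, 2 ≤ n → ∀ q : Fin n → Fin 4 × Fin 4, (∀ i, (q i).1 < (q i).2) →
      ∀ F : 𝓢((Fin n → EuclideanSpace ℝ (Fin 4)), ℂ), IsOffDiagonal F →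
        Tendsto (fun k => ∑' x : Fin n → (Fin 4 → ℤ), ((stateMomentStr G r (μ k) n q x : ℝ) : ℂ) *
          F (fun l => a (β k) • siteToE (x l) + (a (β k) / 2) •
            (EuclideanSpace.single (q l).1 (1 : ℝ) + EuclideanSpace.single (q l).2 (1 : ℝ)))) atTop (𝓝 (T n q F))) :
    ∀ R : EuclideanSpace ℝ (Fin 4) ≃ₗᵢ[ℝ] EuclideanSpace ℝ (Fin 4), IsSignedPerm R → Invariant S₁ R := by
  intro R hR n F hF
  -- a faithful continuous matrix representation of the compact group makes it Hausdorff and second countable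
  haveI : T2Space G := (r.continuous.isClosedEmbedding r.injective).isEmbedding.t2Space
  haveI : SecondCountableTopology G :=
    (r.continuous.isClosedEmbedding r.injective).isEmbedding.secondCountableTopology
  -- the odd-torus limit states are torus limit points, hence hyperoctahedrally invariant
  have hIV : ∀ k, μ k ∈ infiniteVolumeLimitPoints (d := 4) r.ρ (β k) := fun k =>
    mem_infiniteVolumeLimitPoints_of_mem_oddTorusLimitPoints r (hμ k)
  have hPπ : ∀ (k : ℕ) (π : Equiv.Perm (Fin 4)), (μ k).map (configPermZd π) = μ k := fun k π =>
    map_configPermZd_eq_of_mem_infiniteVolumeLimitPoints r.ρ r.continuous (hIV k) π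
  have hΘ : ∀ k : ℕ, (μ k).map (configSiteReflect 0) = μ k := fun k =>
    map_configSiteReflect_zero_eq_of_mem_infiniteVolumeLimitPoints r.ρ r.continuous (hIV k)
  -- coordinate permutations
  have hperm : ∀ (π : Equiv.Perm (Fin 4)) (n : ℕ) (F : 𝓢((Fin n → EuclideanSpace ℝ (Fin 4)), ℂ)),
      IsOffDiagonal F → S₁ n (linActMulti (coordPerm π) F) = S₁ n F := by
    intro π n F hF
    rcases Nat.lt_or_ge n 2 with hn | hn
    · interval_cases n
      · rw [h0, h0, linActMulti_apply]
        exact congrArg F (Subsingleton.elim _ _)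
      · rw [h1, h1]
    · rw [hS n hn, hS n hn F]
      exact sum_limit_linActMulti_coordPerm_eq r μ (fun k => a (β k)) hPπ (fun q F => T n q F)
        (fun q hq F hF => hT n hn q hq F hF) π F hF
  -- the time reflection
  have hθ : ∀ (n : ℕ) (F : 𝓢((Fin n → EuclideanSpace ℝ (Fin 4)), ℂ)), IsOffDiagonal F →
      S₁ n (thetaMulti 4 F) = S₁ n F := by
    intro n F hF
    rcases Nat.lt_or_ge n 2 with hn | hn
    · interval_cases n
      · rw [h0, h0, thetaMulti_apply]
        exact congrArg F (Subsingleton.elim _ _)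
      · rw [h1, h1]
    · rw [hS n hn, hS n hn F]
      refine Finset.sum_congr rfl fun q hq => ?_
      exact limit_thetaMulti_eq r μ (fun k => a (β k)) hΘ (fun q F => T n q F)
        (fun q hq F hF => hT n hn q hq F hF) ((mem_planeStrings_iff q).1 hq) F hF
  exact invariant_linActMulti_of_signedPerm hperm hθ R hR n F hF

end Summit.QuantumFields.YangMills.Theorems.InfiniteVolume.E1

end
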